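import Summits.NavierStokesRegularity.NavierStokesRegularity.Theorems.TerminalTraceTypeITraceScarL3DepthScaledBounds
import Literature.Analysis.FluidPDE.TaoMainEstimateGaussian
import Literature.Analysis.FluidPDE.TypeIRateClassicalRepresentative
import HarnessLib

/-!
# Depth vorticity rigidity, part 10 — Tao's Gaussian lower bound (5.7) at depth for extinct Type-I
# apices with centre concentration (Q2 of ROUND-26) — helper for item `TerminalTrace.TypeITraceScarL3`
# (stmt-NavierStokesRegularity-18385), stub `stub_quietShell_noConcentration` of line `annulus-dichotomy` v4

Seat nsreg-C26-p1 (prover), `--supports stmt-NavierStokesRegularity-18385`; planner of record nsreg-p2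
g28, ROUND-26 §1c (Q2): «DEPTH ⇒ SHELL AT DEPTH (Tao (5.7) verbatim)».

* `exists_depth_ball_mass` — CLASS-UNIFORM GAUSSIAN LOWER BOUND: for every `(C, D₀, κ₀, c₂)` there is
  `Γ > 0` such that: if `(U, P)` is in Albritton–Barker's class on every `Q(a)` with `D ≤ D₀` and rate
  `C/√(−s)`, `v` is a continuous, jointly smooth representative of `U` on the open backward slab which is
  a classical Navier–Stokes solution on every closed strip `[b − T, b]`, `b < 0` (the tree's
  `exists_classical_repr_of_apexPackage`), and `v` has the CENTRE CONCENTRATION of Q1 with constants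
  `(κ₀, c₂)` (`∀ T₁ > 0 ∃ t₁ ∈ [−T₁, −T₁/2] ∀ t ∈ [t₁ − c₂T₁, t₁], ∫_{B(0,√T₁)} |curl v(t)|² ≥ κ₀T₁^{-1/2}`),
  then for all `R' > 0`, `0 < T₁ ≤ R'²` there is `t₁ ∈ [−T₁, −T₁/2]` with
  `∫_{B(200R'e₀, 100R')} |ω(t')|² ≥ κ₀ T₁^{-1/2} e^{−Γ R'²/T₁}` for every `t' ∈ [t₁ − (c₂/2)T₁, t₁]`.
  This is Tao 2021 (5.7) (`vorticity_gaussian_lower_bound`, the tree's second-Carleman consequence) fed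
  with the class-uniform epoch of regularity at depth (`exists_uniform_depth_bounds`).

WHAT THIS IS NOT: not the stub, not item 18385, no statement about Navier–Stokes regularity.
[cite: Tao2021, §5 (5.4)–(5.7)] [folklore; AlbrittonBarker2019 §3]
-/

noncomputable section

set_option linter.dupNamespace false

namespace Summit.NavierStokesRegularity.NavierStokesRegularity.Theorems.TypeITraceScarL3

open MeasureTheory Set Function Filter Topology TopologicalSpace Metric InnerProductSpace
open Literature.Analysis Literature.Analysis.FluidPDE
open scoped NNReal ENNReal RealInnerProductSpace

set_option maxHeartbeats 400000 in
/-- **Gaussian lower bound at depth (Tao (5.7)) for the class, uniform constants.**  See the module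
docstring. [cite: Tao2021, §5 (5.7)] -/
theorem exists_depth_ball_mass (C : ℝ) (D₀ : ℝ≥0) {κ₀ c₂ : ℝ} (hκ₀ : 0 < κ₀) (hc₂ : 0 < c₂)
    (hc₂' : c₂ < 1 / 2) :
    ∃ Γ : ℝ, 0 < Γ ∧
    ∀ (U : ℝ → EuclideanSpace ℝ (Fin 3) → EuclideanSpace ℝ (Fin 3))
      (P : ℝ → EuclideanSpace ℝ (Fin 3) → ℝ)
      (v : ℝ → EuclideanSpace ℝ (Fin 3) → EuclideanSpace ℝ (Fin 3)),
      (∀ a : ℝ, 0 < a →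
        IsSuitableWeakSolutionInBall a (0 : ℝ × EuclideanSpace ℝ (Fin 3)) U P) →
      (∀ z₀ : ℝ × EuclideanSpace ℝ (Fin 3), z₀.1 ≤ 0 →
        ∀ r : ℝ, 0 < r → cknD r z₀ P ≤ D₀) →
      (∀ s : ℝ, s < 0 →
        ∀ᵐ y : EuclideanSpace ℝ (Fin 3), ‖U s y‖ ≤ C / Real.sqrt (-s)) →
      (∀ᵐ w ∂(volume.restrict (Iio (0 : ℝ) ×ˢ (univ : Set (EuclideanSpace ℝ (Fin 3))))),
        uncurry U w = uncurry v w) →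
      ContinuousOn (uncurry v) (Iio 0 ×ˢ univ) →
      IsSmoothSpaceTimeOn (Iio 0) v →
      (∀ b T : ℝ, b < 0 → 0 < T →
        ∃ q : ℝ → EuclideanSpace ℝ (Fin 3) → ℝ, IsClassicalNSSolutionOn (Icc (b - T) b) 1 0 v q) →
      (∀ T₁ : ℝ, 0 < T₁ → ∃ t₁ ∈ Icc (-T₁) (-T₁ / 2), ∀ t ∈ Icc (t₁ - c₂ * T₁) t₁,
        κ₀ * T₁ ^ (-(1 / 2 : ℝ)) ≤
          ∫ x in ball (0 : EuclideanSpace ℝ (Fin 3)) (Real.sqrt T₁), ‖curl (v t) x‖ ^ 2) →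
      ∀ R' T₁ : ℝ, 0 < R' → 0 < T₁ → T₁ ≤ R' ^ 2 →
        ∃ t₁ ∈ Icc (-T₁) (-T₁ / 2), ∀ t' ∈ Icc (t₁ - c₂ / 2 * T₁) t₁,
          κ₀ * T₁ ^ (-(1 / 2 : ℝ)) * Real.exp (-(Γ * R' ^ 2 / T₁)) ≤
            ∫ x in ball ((200 * R') • EuclideanSpace.single (0 : Fin 3) (1 : ℝ)) (100 * R'),
              ‖vorticity v t' x‖ ^ 2 := by
  -- ### the class constants
  obtain ⟨K₀, hK₀64, h57⟩ := Literature.Analysis.FluidPDE.vorticity_gaussian_lower_bound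
  obtain ⟨Kd, hKd1, hKd⟩ := exists_uniform_depth_bounds C D₀
  have hKd0 : 0 < Kd := by linarith
  have hK₀0 : 0 < K₀ := by linarith
  set κ : ℝ := ‖curlCLM‖ with hκdef
  have hκ0 : 0 ≤ κ := by rw [hκdef]; exact norm_nonneg curlCLM
  set c' : ℝ := min (c₂ / 2) (1 / Kd ^ 2) with hc'def
  have hc'0 : 0 < c' := lt_min (by positivity) (by positivity)
  have hc'c₂ : c' ≤ c₂ / 2 := min_le_left _ _
  have hc'Kd : c' ≤ 1 / Kd ^ 2 := min_le_right _ _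
  have hc'1 : c' ≤ 1 := by
    refine hc'Kd.trans ?_
    rw [div_le_one (by positivity)]; nlinarith
  set M : ℝ := max 1 (κ * Kd) with hMdef
  have hM1 : 1 ≤ M := le_max_left _ _
  have hMκ : κ * Kd ≤ M := le_max_right _ _
  have hM0 : 0 < M := by linarith
  set X : ℝ := K₀ * M ^ 2 / (κ₀ * Real.sqrt c') with hXdef
  have hX0 : 0 < X := by positivity
  set a : ℝ := max K₀ (Real.log X) with hadef
  have haK₀ : K₀ ≤ a := le_max_left _ _
  have ha0 : 0 < a := hK₀0.trans_le haK₀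
  set Γ : ℝ := K₀ * a ^ 3 * 200 ^ 2 / c' with hΓdef
  have hΓ0 : 0 < Γ := by positivity
  refine ⟨Γ, hΓ0, ?_⟩
  intro U P v hsw hD hrate hvU hvc hvs hcl hQ1 R' T₁ hR' hT₁ hT₁R
  obtain ⟨t₁, ht₁, hfloor⟩ := hQ1 T₁ hT₁
  refine ⟨t₁, ht₁, fun t' ht' => ?_⟩
  -- ### the window `[t' - T₅, t']`, `T₅ = c' T₁`
  set T₅ : ℝ := c' * T₁ with hT₅def
  have hT₅0 : 0 < T₅ := mul_pos hc'0 hT₁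
  have ht'neg : t' < 0 := by linarith [ht'.2, ht₁.2]
  obtain ⟨q, hclass⟩ := hcl t' T₅ ht'neg hT₅0
  have hwin : Icc (t' - T₅) t' ⊆ Icc (t₁ - c₂ * T₁) t₁ := by
    refine Icc_subset_Icc ?_ ht'.2
    have h1 : T₅ ≤ c₂ / 2 * T₁ := mul_le_mul_of_nonneg_right hc'c₂ hT₁.le
    linarith [ht'.1]
  have hstrip : Icc (t₁ - c₂ * T₁) t₁ ⊆ Ioo (-2 * T₁) (-T₁ / 4) := by
    intro t ht
    constructor
    · nlinarith [ht.1, ht₁.1, hc₂']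
    · linarith [ht.2, ht₁.2]
  -- ### the depth representative hypotheses for `v` on the `T₁`-strip
  have hvU' : uncurry v =ᵐ[volume.restrict
      (Ioo (-2 * T₁) (-T₁ / 4) ×ˢ (univ : Set (EuclideanSpace ℝ (Fin 3))))] uncurry U := by
    have h : ∀ᵐ w ∂(volume.restrict (Ioo (-2 * T₁) (-T₁ / 4) ×ˢ (univ : Set (EuclideanSpace ℝ (Fin 3))))),
        uncurry U w = uncurry v w :=
      ae_restrict_of_ae_restrict_of_subset (prod_mono (fun s hs => by
        show s < 0; linarith [hs.2]) Subset.rfl) hvU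
    filter_upwards [h] with w hw using hw.symm
  have hvc' : ContinuousOn (uncurry v) (Ioo (-2 * T₁) (-T₁ / 4) ×ˢ (univ : Set (EuclideanSpace ℝ (Fin 3)))) :=
    hvc.mono (prod_mono (fun s hs => by show s < 0; linarith [hs.2]) Subset.rfl)
  have hvsmooth : ∀ t < 0, ContDiff ℝ (⊤ : ℕ∞) (v t) := fun t ht =>
    hvs.contDiff_slice (show t ∈ Iio (0 : ℝ) from ht)
  have hv2 : ∀ t ∈ Ioo (-2 * T₁) (-T₁ / 4), ContDiff ℝ 2 (v t) := fun t ht =>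
    (hvsmooth t (by linarith [ht.2])).of_le (by norm_cast)
  have hbds := hKd U P hsw hD hrate T₁ hT₁ v hvU' hvc' hv2
  -- vorticity bounds from the velocity bounds
  have hDf : ∀ t < 0, ∀ y, ContDiffAt ℝ (⊤ : ℕ∞) (fderiv ℝ (v t)) y := fun t ht y =>
    ((hvsmooth t ht).fderiv_right (m := (⊤ : ℕ∞)) (by norm_cast)).contDiffAt
  have hvort : ∀ t, vorticity v t = curlCLM ∘ fderiv ℝ (v t) := fun t => by funext y; rfl
  have hω0 : ∀ t ∈ Ioo (-2 * T₁) (-T₁ / 4), ∀ y, ‖vorticity v t y‖ ≤ κ * (Kd / T₁) := fun t ht y => by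
    rw [vorticity_apply]
    exact (norm_curl_le _ _).trans (mul_le_mul_of_nonneg_left (hbds t ht y).2.1 hκ0)
  have hω1 : ∀ t ∈ Ioo (-2 * T₁) (-T₁ / 4), ∀ y,
      ‖fderiv ℝ (vorticity v t) y‖ ≤ κ * (Kd / (T₁ * Real.sqrt T₁)) := fun t ht y => by
    have htneg : t < 0 := by linarith [ht.2]
    rw [← norm_iteratedFDeriv_one, hvort t]
    refine (ContinuousLinearMap.norm_iteratedFDeriv_comp_left curlCLM (hDf t htneg y) (by norm_cast)).trans ?_
    rw [norm_iteratedFDeriv_fderiv]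
    exact mul_le_mul_of_nonneg_left (hbds t ht y).2.2 hκ0
  -- ### the hypotheses of Tao's (5.7)
  have hsT₁ : 0 < Real.sqrt T₁ := Real.sqrt_pos.2 hT₁
  have hsT₅ : 0 < Real.sqrt T₅ := Real.sqrt_pos.2 hT₅0
  have hsc' : 0 < Real.sqrt c' := Real.sqrt_pos.2 hc'0
  have hsqT₅ : Real.sqrt T₅ = Real.sqrt c' * Real.sqrt T₁ := by
    rw [hT₅def, Real.sqrt_mul hc'0.le]
  have hc'sq : Real.sqrt c' * Kd ≤ 1 := by
    have h1 : c' * Kd ^ 2 ≤ 1 := by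
      have := mul_le_mul_of_nonneg_right hc'Kd (sq_nonneg Kd)
      rwa [one_div, inv_mul_cancel₀ (by positivity)] at this
    have h2 : Real.sqrt (c' * Kd ^ 2) ≤ 1 := Real.sqrt_le_one.mpr h1 |>.trans_eq' (by rfl) |> fun h => by
      simpa using Real.sqrt_le_sqrt h1
    rw [Real.sqrt_mul hc'0.le, Real.sqrt_sq hKd0.le] at h2
    exact h2
  have h55 : ∀ t ∈ Icc (t' - T₅) t', ∀ x : EuclideanSpace ℝ (Fin 3),
      ‖v t x‖ ≤ (Real.sqrt T₅)⁻¹ ∧ ‖fderiv ℝ (v t) x‖ ≤ T₅⁻¹ := by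
    intro t ht x
    have hts : t ∈ Ioo (-2 * T₁) (-T₁ / 4) := hstrip (hwin ht)
    obtain ⟨h0, h1, -⟩ := hbds t hts x
    constructor
    · calc ‖v t x‖ ≤ Kd / Real.sqrt T₁ := h0
        _ ≤ (Real.sqrt T₅)⁻¹ := by
          rw [hsqT₅, div_le_iff₀ hsT₁, mul_inv, mul_assoc, inv_mul_cancel₀ hsT₁.ne', mul_one,
            le_inv_comm₀ hKd0 hsc']
          calc Real.sqrt c' = Real.sqrt c' * Kd * Kd⁻¹ := by field_simp
            _ ≤ 1 * Kd⁻¹ := mul_le_mul_of_nonneg_right hc'sq (by positivity)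
            _ = Kd⁻¹ := one_mul _
    · calc ‖fderiv ℝ (v t) x‖ ≤ Kd / T₁ := h1
        _ ≤ T₅⁻¹ := by
          rw [hT₅def, mul_inv, div_eq_mul_inv]
          refine mul_le_mul_of_nonneg_right ?_ (by positivity)
          rw [le_inv_comm₀ hKd0 hc'0]
          calc c' ≤ 1 / Kd ^ 2 := hc'Kd
            _ ≤ Kd⁻¹ := by
              rw [one_div, inv_le_inv₀ (by positivity) hKd0]; nlinarith
  have h54 : ∀ t ∈ Icc (t' - T₅) t', ∀ x : EuclideanSpace ℝ (Fin 3),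
      ‖vorticity v t x‖ ≤ M / T₅ ∧ ‖fderiv ℝ (vorticity v t) x‖ ≤ M / (T₅ * Real.sqrt T₅) := by
    intro t ht x
    have hts : t ∈ Ioo (-2 * T₁) (-T₁ / 4) := hstrip (hwin ht)
    constructor
    · calc ‖vorticity v t x‖ ≤ κ * (Kd / T₁) := hω0 t hts x
        _ = (κ * Kd * c') / T₅ := by rw [hT₅def]; field_simp
        _ ≤ M / T₅ := by
          refine div_le_div_of_nonneg_right ?_ hT₅0.le
          calc κ * Kd * c' ≤ M * 1 := mul_le_mul hMκ hc'1 hc'0.le hM0.le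
            _ = M := mul_one _
    · calc ‖fderiv ℝ (vorticity v t) x‖ ≤ κ * (Kd / (T₁ * Real.sqrt T₁)) := hω1 t hts x
        _ = (κ * Kd * (c' * Real.sqrt c')) / (T₅ * Real.sqrt T₅) := by
          rw [hsqT₅, hT₅def]; field_simp
        _ ≤ M / (T₅ * Real.sqrt T₅) := by
          refine div_le_div_of_nonneg_right ?_ (by positivity)
          have h1 : c' * Real.sqrt c' ≤ 1 := by
            have : Real.sqrt c' ≤ 1 := Real.sqrt_le_one.mpr hc'1 |> fun h => by simpa using h
            nlinarith [hsc'.le]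
          calc κ * Kd * (c' * Real.sqrt c') ≤ M * 1 := mul_le_mul hMκ h1 (by positivity) hM0.le
            _ = M := mul_one _
  have h56 : ∀ t ∈ Icc (t' - T₅) t', κ₀ * T₁ ^ (-(1 / 2 : ℝ)) ≤
      ∫ x in ball (0 : EuclideanSpace ℝ (Fin 3)) (Real.sqrt T₁), ‖vorticity v t x‖ ^ 2 := by
    intro t ht
    have h := hfloor t (hwin ht)
    simpa only [vorticity_apply] using h
  have hsmall : K₀ * M ^ 2 * Real.exp (-a) ≤ κ₀ * T₁ ^ (-(1 / 2 : ℝ)) * Real.sqrt T₅ := by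
    have hδT : κ₀ * T₁ ^ (-(1 / 2 : ℝ)) * Real.sqrt T₅ = κ₀ * Real.sqrt c' := by
      rw [hsqT₅, Real.rpow_neg hT₁.le, ← Real.sqrt_eq_rpow]
      field_simp
    rw [hδT]
    have h1 : Real.exp (-a) ≤ X⁻¹ := by
      have h2 : Real.exp (-a) ≤ Real.exp (-Real.log X) :=
        Real.exp_le_exp.2 (neg_le_neg (le_max_right _ _))
      rwa [Real.exp_neg (Real.log X), Real.exp_log hX0] at h2
    calc K₀ * M ^ 2 * Real.exp (-a) ≤ K₀ * M ^ 2 * X⁻¹ :=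
          mul_le_mul_of_nonneg_left h1 (by positivity)
      _ = κ₀ * Real.sqrt c' := by rw [hXdef]; field_simp
  -- the centre `x₀ = 200 R' e₀`
  set e₀ : EuclideanSpace ℝ (Fin 3) := EuclideanSpace.single (0 : Fin 3) (1 : ℝ) with he₀
  have he₀n : ‖e₀‖ = 1 := by
    rw [he₀, ← EuclideanSpace.basisFun_apply]
    exact (EuclideanSpace.basisFun (Fin 3) ℝ).orthonormal.1 0
  set x₀ : EuclideanSpace ℝ (Fin 3) := (200 * R') • e₀ with hx₀
  have hx₀n : ‖x₀‖ = 200 * R' := by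
    rw [hx₀, norm_smul, he₀n, mul_one, Real.norm_eq_abs, abs_of_pos (by positivity)]
  have hρx : Real.sqrt T₁ ≤ ‖x₀‖ := by
    rw [hx₀n]
    have h1 : Real.sqrt T₁ ≤ R' := by
      rw [Real.sqrt_le_left hR'.le]; exact hT₁R
    linarith
  have hTx : T₅ ≤ ‖x₀‖ ^ 2 := by
    rw [hx₀n, hT₅def]
    have : c' * T₁ ≤ 1 * R' ^ 2 := mul_le_mul hc'1 hT₁R hT₁.le zero_le_one
    nlinarith
  have hres := h57 hclass hT₅0 x₀ haK₀ hM1 (by positivity : (0 : ℝ) < κ₀ * T₁ ^ (-(1 / 2 : ℝ)))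
    hsT₁ hρx hTx h55 h54 h56 hsmall
  -- ### read off the conclusion
  have hexp : Real.exp (-(K₀ * a ^ 3 * ‖x₀‖ ^ 2 / T₅)) = Real.exp (-(Γ * R' ^ 2 / T₁)) := by
    congr 2
    rw [hx₀n, hΓdef, hT₅def]
    field_simp
  rw [hexp, hx₀n, show 200 * R' / 2 = 100 * R' by ring] at hres
  exact hres

end Summit.NavierStokesRegularity.NavierStokesRegularity.Theorems.TypeITraceScarL3

end
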